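import Summits.AtomisticToContinuum.HydrodynamicLimit.Theorems.ImplosionDichotomyDenseExcursionConeDefs
import Summits.AtomisticToContinuum.HydrodynamicLimit.Theorems.ImplosionDichotomyDenseExcursionProjectiveCovariance
import Literature.Analysis.FluidPDE.IsentropicEulerFiniteSpeedOfPropagation

/-!
# Kidder images of ideal solutions are ideal solutions (line `kidder-knob-melnikov`, stub `stub_memberCore`)

Helper file (`--supports stmt-AtomisticToContinuum-12586`) for the registered stub
`stub_memberCore : HsEulerConeLocality → ProjectiveCovariance → MemberCore` of the crux
`Summit.AtomisticToContinuum.HydrodynamicLimit.Theses.ImplosionDichotomy.DenseExcursion`.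

**Content.**
* `MemberCoreProof.eulerZAt_one_iff_athermalEulerAt` — the BRIDGE between the two typings of the primitive
  ideal monatomic Euler system in the tree: the uncurried `EulerZAt d h (fun _ => 1) P Θ U (t, x)` of
  `…ProjectiveCovariance.lean` (`fderiv` on `ℝ × ℝ³` along `(1, 0)` and `(0, eᵢ)`, conservative mass flux,
  componentwise momentum; at `Z ≡ 1` the diameter `d` and the heating `h` drop out) and the curried
  `AthermalEulerAt (fun _ => 1)` of `…ConeDefs.lean` (Mathlib `deriv` in `t`, `fderiv`/`gradient` in `x`),
  for fields jointly differentiable at the point (`hasDerivAt_slice_left/right`, product rule, `∇ = D♯`).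
* `memberCore_kidder_solves` — the KIDDER TRANSFORM of a `C¹` solution is a solution: if curried fields
  `(P₀, Θ₀, U₀)` are jointly `C¹` on `{t < T} × ℝ³` and solve `AthermalEulerAt 1` there, then for every `b`
  the fields `kScalar 3 P₀ b`, `kScalar 2 Θ₀ b`, `kVel U₀ b` (`λ³P₀(λt, λy)`, `λ²Θ₀(λt, λy)`,
  `λ(U₀(λt, λy) − b y)`, `λ = (1 − bt)⁻¹`) solve it at every `(t, y)` with `0 < 1 − bt`, `λ t < T`. For
  `b ≠ 0` these are exactly the dual fields `dualDensity/Temperature/Velocity a` of the clock map with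
  `a = −1/b` (`kScalar_eq_dualDensity` …), so the three residual identities `dual_mass`,
  `dual_momentum`, `dual_temperature` of `…ProjectiveCovariance.lean` (valid for `a ≠ 0`, `a + t ≠ 0`:
  both signs of `b`, which `ProjectiveCovariance` itself — stated for `0 < a` — does not cover) transport
  the system; `b = 0` is the identity (`kScalar_zero`, `kVel_zero`). D. Serre 1997, Prop. 2.1.
-/

noncomputable section

open Set Filter Topology InnerProductSpace
open scoped ContDiff RealInnerProductSpace

namespace Summit.AtomisticToContinuum.HydrodynamicLimit.Theorems.KidderKnobMelnikov

open Literature.MathematicalPhysics.KineticTheory (V3)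
open Literature.Analysis.FluidPDE (IsentropicEuler.hasDerivAt_slice_left IsentropicEuler.hasFDerivAt_slice_right
  IsentropicEuler.clm_apply_eq_sum IsentropicEuler.inner_gradient_eq_fderiv)

namespace MemberCoreProof

/-! ## Curried versus uncurried derivatives -/

section Slices

variable {G : Type*} [NormedAddCommGroup G] [NormedSpace ℝ G] {F : ℝ × V3 → G} {t : ℝ} {x : V3}

/-- `∂ₜ` of an uncurried field is the `deriv` of its time slice. [folklore] -/
theorem dT_eq_deriv (hF : DifferentiableAt ℝ F (t, x)) : dT F (t, x) = deriv (fun s => F (s, x)) t :=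
  (IsentropicEuler.hasDerivAt_slice_left hF.hasFDerivAt).deriv.symm

/-- `∂ᵢ` of an uncurried field is the `fderiv` of its space slice along `eᵢ`. [folklore] -/
theorem dX_eq_fderiv (hF : DifferentiableAt ℝ F (t, x)) (i : Fin 3) :
    dX i F (t, x) = fderiv ℝ (fun y => F (t, y)) x (EuclideanSpace.single i 1) := by
  rw [(IsentropicEuler.hasFDerivAt_slice_right hF.hasFDerivAt).fderiv, ContinuousLinearMap.comp_apply,
    ContinuousLinearMap.inr_apply]
  rfl

/-- Time slices of a jointly differentiable field are differentiable. [folklore] -/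
theorem differentiableAt_slice_time (hF : DifferentiableAt ℝ F (t, x)) :
    DifferentiableAt ℝ (fun s => F (s, x)) t :=
  (IsentropicEuler.hasDerivAt_slice_left hF.hasFDerivAt).differentiableAt

/-- Space slices of a jointly differentiable field are differentiable. [folklore] -/
theorem differentiableAt_slice_space (hF : DifferentiableAt ℝ F (t, x)) :
    DifferentiableAt ℝ (fun y => F (t, y)) x :=
  (IsentropicEuler.hasFDerivAt_slice_right hF.hasFDerivAt).differentiableAt

end Slices

/-! ## Coordinates of vector derivatives -/

/-- Coordinates commute with `deriv`. [folklore] -/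
theorem deriv_apply_coord {U : ℝ → V3} {t : ℝ} (hU : DifferentiableAt ℝ U t) (j : Fin 3) :
    deriv U t j = deriv (fun s => U s j) t := by
  have h := ((EuclideanSpace.proj j).hasFDerivAt.comp_hasDerivAt t hU.hasDerivAt).deriv
  simp only [Function.comp_def] at h
  simpa using h.symm

/-- Coordinates commute with `fderiv`. [folklore] -/
theorem fderiv_apply_coord {f : V3 → V3} {x : V3} (hf : DifferentiableAt ℝ f x) (v : V3) (j : Fin 3) :
    fderiv ℝ f x v j = fderiv ℝ (fun y => f y j) x v := by
  have h := ((EuclideanSpace.proj j : V3 →L[ℝ] ℝ).hasFDerivAt.comp x hf.hasFDerivAt).fderiv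
  rw [show (fun y => f y j) = (EuclideanSpace.proj j : V3 →L[ℝ] ℝ) ∘ f from rfl, h]
  rfl

/-- Coordinates of the gradient are the partial derivatives. [folklore] -/
theorem gradient_apply_eq_fderiv (f : V3 → ℝ) (x : V3) (j : Fin 3) :
    gradient f x j = fderiv ℝ f x (EuclideanSpace.single j 1) := by
  rw [← IsentropicEuler.inner_gradient_eq_fderiv, EuclideanSpace.inner_single_right]
  simp

/-! ## The bridge -/

section Bridge

variable {P Θ : ℝ → V3 → ℝ} {U : ℝ → V3 → V3} {t : ℝ} {x : V3}
  (hP : DifferentiableAt ℝ (fun w : ℝ × V3 => P w.1 w.2) (t, x))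
  (hΘ : DifferentiableAt ℝ (fun w : ℝ × V3 => Θ w.1 w.2) (t, x))
  (hU : DifferentiableAt ℝ (fun w : ℝ × V3 => U w.1 w.2) (t, x))

include hU in
/-- Components of a jointly differentiable vector field are jointly differentiable. [folklore] -/
theorem differentiableAt_uncurry_coord (j : Fin 3) :
    DifferentiableAt ℝ (fun w : ℝ × V3 => U w.1 w.2 j) (t, x) :=
  differentiableAt_euclidean.mp hU j

include hP hU in
/-- **Mass residual**: conservative uncurried form = primitive curried form. [folklore] -/
theorem bridge_mass :
    dT (fun w : ℝ × V3 => P w.1 w.2) (t, x) + ∑ i, dX i (fun w : ℝ × V3 => P w.1 w.2 * U w.1 w.2 i) (t, x) =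
      deriv (fun s => P s x) t + fderiv ℝ (P t) x (U t x) +
        P t x * ∑ i, fderiv ℝ (U t) x (EuclideanSpace.single i 1) i := by
  have hUi : ∀ i, DifferentiableAt ℝ (fun w : ℝ × V3 => U w.1 w.2 i) (t, x) :=
    differentiableAt_uncurry_coord hU
  have hPs : DifferentiableAt ℝ (P t) x := differentiableAt_slice_space hP
  have hUs : DifferentiableAt ℝ (U t) x := differentiableAt_slice_space hU
  have hUis : ∀ i, DifferentiableAt ℝ (fun y => U t y i) x := fun i => differentiableAt_slice_space (hUi i)
  have h0 : dT (fun w : ℝ × V3 => P w.1 w.2) (t, x) = deriv (fun s => P s x) t := dT_eq_deriv hP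
  have hX : ∀ i, dX i (fun w : ℝ × V3 => P w.1 w.2 * U w.1 w.2 i) (t, x) =
      P t x * fderiv ℝ (fun y => U t y i) x (EuclideanSpace.single i 1) +
        U t x i * fderiv ℝ (P t) x (EuclideanSpace.single i 1) := by
    intro i
    have h1 : dX i (fun w : ℝ × V3 => P w.1 w.2 * U w.1 w.2 i) (t, x) =
        fderiv ℝ (fun y => P t y * U t y i) x (EuclideanSpace.single i 1) := dX_eq_fderiv (hP.mul (hUi i)) i
    rw [h1, fderiv_fun_mul hPs (hUis i)]
    simp only [add_apply, smul_apply, smul_eq_mul]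
  rw [h0, Finset.sum_congr rfl fun i _ => hX i, IsentropicEuler.clm_apply_eq_sum (fderiv ℝ (P t) x) (U t x),
    Finset.sum_add_distrib, Finset.mul_sum]
  simp only [smul_eq_mul, fderiv_apply_coord hUs]
  ring

include hP hΘ hU in
/-- **Momentum residual, `j`-th component** (`Z ≡ 1`): uncurried form = `j`-th coordinate of the curried
vector form. [folklore] -/
theorem bridge_momentum (j : Fin 3) :
    P t x * (dT (fun w : ℝ × V3 => U w.1 w.2 j) (t, x) +
        ∑ i, U t x i * dX i (fun w : ℝ × V3 => U w.1 w.2 j) (t, x)) +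
      dX j (fun w : ℝ × V3 => P w.1 w.2 * Θ w.1 w.2 * 1) (t, x) =
    (P t x • (deriv (fun s => U s x) t + fderiv ℝ (U t) x (U t x)) +
      Θ t x • gradient (P t) x + P t x • gradient (Θ t) x) j := by
  have hUj : DifferentiableAt ℝ (fun w : ℝ × V3 => U w.1 w.2 j) (t, x) := differentiableAt_uncurry_coord hU j
  have hPs : DifferentiableAt ℝ (P t) x := differentiableAt_slice_space hP
  have hΘs : DifferentiableAt ℝ (Θ t) x := differentiableAt_slice_space hΘ
  have hUs : DifferentiableAt ℝ (U t) x := differentiableAt_slice_space hU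
  have hUt : DifferentiableAt ℝ (fun s => U s x) t := differentiableAt_slice_time hU
  have hPΘ : DifferentiableAt ℝ (fun w : ℝ × V3 => P w.1 w.2 * Θ w.1 w.2 * 1) (t, x) :=
    (hP.mul hΘ).mul_const 1
  have h1 : dT (fun w : ℝ × V3 => U w.1 w.2 j) (t, x) = deriv (fun s => U s x j) t := dT_eq_deriv hUj
  have h2 : ∀ i, dX i (fun w : ℝ × V3 => U w.1 w.2 j) (t, x) =
      fderiv ℝ (fun y => U t y j) x (EuclideanSpace.single i 1) := fun i => dX_eq_fderiv hUj i
  have h3 : dX j (fun w : ℝ × V3 => P w.1 w.2 * Θ w.1 w.2 * 1) (t, x) =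
      Θ t x * fderiv ℝ (P t) x (EuclideanSpace.single j 1) +
        P t x * fderiv ℝ (Θ t) x (EuclideanSpace.single j 1) := by
    have h : dX j (fun w : ℝ × V3 => P w.1 w.2 * Θ w.1 w.2 * 1) (t, x) =
        fderiv ℝ (fun y => P t y * Θ t y * 1) x (EuclideanSpace.single j 1) := dX_eq_fderiv hPΘ j
    rw [h]
    simp only [mul_one]
    rw [fderiv_fun_mul hPs hΘs]
    simp only [add_apply, smul_apply, smul_eq_mul]
    ring
  rw [h1, Finset.sum_congr rfl fun i _ => by rw [h2 i], h3]
  simp only [PiLp.add_apply, PiLp.smul_apply, smul_eq_mul, gradient_apply_eq_fderiv, deriv_apply_coord hUt,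
    fderiv_apply_coord hUs]
  rw [IsentropicEuler.clm_apply_eq_sum (fderiv ℝ (fun y => U t y j) x) (U t x)]
  simp only [smul_eq_mul]
  ring

include hΘ hU in
/-- **Temperature residual** (`Z ≡ 1`): uncurried form = curried form. [folklore] -/
theorem bridge_temperature :
    dT (fun w : ℝ × V3 => Θ w.1 w.2) (t, x) + ∑ i, U t x i * dX i (fun w : ℝ × V3 => Θ w.1 w.2) (t, x) +
        2 / 3 * Θ t x * 1 * ∑ i, dX i (fun w : ℝ × V3 => U w.1 w.2 i) (t, x) =
      deriv (fun s => Θ s x) t + fderiv ℝ (Θ t) x (U t x) +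
        2 / 3 * Θ t x * ∑ i, fderiv ℝ (U t) x (EuclideanSpace.single i 1) i := by
  have hUi : ∀ i, DifferentiableAt ℝ (fun w : ℝ × V3 => U w.1 w.2 i) (t, x) :=
    differentiableAt_uncurry_coord hU
  have hUs : DifferentiableAt ℝ (U t) x := differentiableAt_slice_space hU
  have h1 : dT (fun w : ℝ × V3 => Θ w.1 w.2) (t, x) = deriv (fun s => Θ s x) t := dT_eq_deriv hΘ
  have h2 : ∀ i, dX i (fun w : ℝ × V3 => Θ w.1 w.2) (t, x) = fderiv ℝ (Θ t) x (EuclideanSpace.single i 1) :=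
    fun i => dX_eq_fderiv hΘ i
  have h3 : ∀ i, dX i (fun w : ℝ × V3 => U w.1 w.2 i) (t, x) = fderiv ℝ (U t) x (EuclideanSpace.single i 1) i :=
    fun i => by rw [fderiv_apply_coord hUs]; exact dX_eq_fderiv (hUi i) i
  rw [h1, Finset.sum_congr rfl fun i _ => by rw [h2 i], Finset.sum_congr rfl fun i _ => h3 i,
    IsentropicEuler.clm_apply_eq_sum (fderiv ℝ (Θ t) x) (U t x)]
  simp only [smul_eq_mul, mul_one]

include hP hΘ hU in
/-- **The bridge.** At `Z ≡ 1` (ideal monatomic gas: the diameter `d` and the heating `h` are then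
irrelevant), for fields jointly differentiable at `(t, x)`, the uncurried system `EulerZAt` of
`…ProjectiveCovariance.lean` holds at `(t, x)` iff the curried `AthermalEulerAt (fun _ => 1)` of `…ConeDefs.lean`
does. [folklore] -/
theorem eulerZAt_one_iff_athermalEulerAt (d h : ℝ → ℝ) :
    EulerZAt d h (fun _ => 1) (fun w : ℝ × V3 => P w.1 w.2) (fun w : ℝ × V3 => Θ w.1 w.2)
        (fun w : ℝ × V3 => U w.1 w.2) (t, x) ↔
      AthermalEulerAt (fun _ => 1) P Θ U t x := by
  rw [athermalEulerAt_one_iff]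
  unfold EulerZAt
  dsimp only
  rw [bridge_mass hP hU, bridge_temperature hΘ hU, sub_self, mul_zero]
  refine and_congr Iff.rfl (and_congr ?_ Iff.rfl)
  constructor
  · intro hj
    ext j
    rw [← bridge_momentum hP hΘ hU j, PiLp.zero_apply]
    exact hj j
  · intro hv j
    rw [bridge_momentum hP hΘ hU j, hv, PiLp.zero_apply]

end Bridge

/-! ## The Kidder dictionary `a = −1/b` -/

section Kidder

variable {b : ℝ}

/-- The clock factor of `clockMap (−b⁻¹)` is the Kidder factor `λ = (1 − bs)⁻¹` (all `s`; both sides vanish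
at the pole `bs = 1`). [folklore] -/
theorem kidder_clockFactor (hb : b ≠ 0) (s : ℝ) : -b⁻¹ / (-b⁻¹ + s) = (1 - b * s)⁻¹ := by
  have hden : -b⁻¹ + s = -(1 - b * s) / b := by field_simp; ring
  by_cases h : 1 - b * s = 0
  · rw [hden, h]; simp
  · rw [hden]; field_simp

/-- The physical time of `clockMap (−b⁻¹)` is `λ s`. [folklore] -/
theorem kidder_clockTime (hb : b ≠ 0) (s : ℝ) : -b⁻¹ * s / (-b⁻¹ + s) = (1 - b * s)⁻¹ * s := by
  rw [mul_comm (-b⁻¹) s, mul_div_assoc, kidder_clockFactor hb, mul_comm]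

/-- The Hubble coefficient of the dual velocity is `−bλ`. [folklore] -/
theorem kidder_hubble (hb : b ≠ 0) (s : ℝ) : 1 / (-b⁻¹ + s) = -(b * (1 - b * s)⁻¹) := by
  have hden : -b⁻¹ + s = -(1 - b * s) / b := by field_simp; ring
  by_cases h : 1 - b * s = 0
  · rw [hden, h]; simp
  · rw [hden]; field_simp

/-- `clockMap (−b⁻¹) (s, y) = (λ s, λ y)`. [folklore] -/
theorem clockMap_kidder (hb : b ≠ 0) (s : ℝ) (y : V3) :
    clockMap (-b⁻¹) (s, y) = ((1 - b * s)⁻¹ * s, (1 - b * s)⁻¹ • y) := by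
  simp only [clockMap, kidder_clockTime hb, kidder_clockFactor hb]

/-- The dual density of the clock map `a = −1/b` is the Kidder image `kScalar 3`. [folklore] -/
theorem dualDensity_kidder (hb : b ≠ 0) (P₀ : ℝ → V3 → ℝ) :
    dualDensity (-b⁻¹) (fun w : ℝ × V3 => P₀ w.1 w.2) = fun w : ℝ × V3 => kScalar 3 P₀ b w.1 w.2 := by
  funext w
  obtain ⟨s, y⟩ := w
  simp only [dualDensity, kScalar, clockMap_kidder hb, kidder_clockFactor hb]

/-- The dual temperature of the clock map `a = −1/b` is the Kidder image `kScalar 2`. [folklore] -/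
theorem dualTemperature_kidder (hb : b ≠ 0) (Θ₀ : ℝ → V3 → ℝ) :
    dualTemperature (-b⁻¹) (fun w : ℝ × V3 => Θ₀ w.1 w.2) = fun w : ℝ × V3 => kScalar 2 Θ₀ b w.1 w.2 := by
  funext w
  obtain ⟨s, y⟩ := w
  simp only [dualTemperature, kScalar, clockMap_kidder hb, kidder_clockFactor hb]

/-- The dual velocity of the clock map `a = −1/b` is the Kidder image `kVel`. [folklore] -/
theorem dualVelocity_kidder (hb : b ≠ 0) (U₀ : ℝ → V3 → V3) :
    dualVelocity (-b⁻¹) (fun w : ℝ × V3 => U₀ w.1 w.2) = fun w : ℝ × V3 => kVel U₀ b w.1 w.2 := by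
  funext w
  obtain ⟨s, y⟩ := w
  simp only [dualVelocity, kVel, clockMap_kidder hb, kidder_clockFactor hb, kidder_hubble hb]
  module

end Kidder

/-! ## The Kidder image of a solution is a solution -/

section Transform

variable {T b : ℝ} {P₀ Θ₀ : ℝ → V3 → ℝ} {U₀ : ℝ → V3 → V3}
  (hP₀ : ContDiffOn ℝ 1 (fun w : ℝ × V3 => P₀ w.1 w.2) (Iio T ×ˢ univ))
  (hΘ₀ : ContDiffOn ℝ 1 (fun w : ℝ × V3 => Θ₀ w.1 w.2) (Iio T ×ˢ univ))
  (hU₀ : ContDiffOn ℝ 1 (fun w : ℝ × V3 => U₀ w.1 w.2) (Iio T ×ˢ univ))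
  (hsol : ∀ t, t < T → ∀ x : V3, AthermalEulerAt (fun _ => 1) P₀ Θ₀ U₀ t x)

omit hsol in
/-- A field `C¹` on the open slab `{t < T} × ℝ³` is differentiable at its points. [folklore] -/
theorem differentiableAt_of_slab {G : Type*} [NormedAddCommGroup G] [NormedSpace ℝ G] {F : ℝ × V3 → G}
    (hF : ContDiffOn ℝ 1 F (Iio T ×ˢ univ)) {t : ℝ} (ht : t < T) (x : V3) : DifferentiableAt ℝ F (t, x) :=
  (hF.differentiableOn (by simp)).differentiableAt
    ((isOpen_Iio.prod isOpen_univ).mem_nhds (mk_mem_prod ht (mem_univ x)))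

include hP₀ hΘ₀ hU₀ hsol in
/-- **Kidder transform, `b ≠ 0`.** [folklore] -/
theorem athermalEulerAt_kidder_of_ne (hb : b ≠ 0) {s : ℝ} (hs : 0 < 1 - b * s)
    (hsT : (1 - b * s)⁻¹ * s < T) (y : V3) :
    AthermalEulerAt (fun _ => 1) (kScalar 3 P₀ b) (kScalar 2 Θ₀ b) (kVel U₀ b) s y := by
  set a : ℝ := -b⁻¹ with ha_def
  have ha : a ≠ 0 := neg_ne_zero.mpr (inv_ne_zero hb)
  have hlam : a / (a + s) = (1 - b * s)⁻¹ := kidder_clockFactor hb s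
  have hℓ : a / (a + s) ≠ 0 := by rw [hlam]; exact (inv_pos.mpr hs).ne'
  have hm : a + ((s, y) : ℝ × V3).1 ≠ 0 := fun h => hℓ (by rw [show a + s = 0 from h, div_zero])
  have hcm : clockMap a (s, y) = ((1 - b * s)⁻¹ * s, (1 - b * s)⁻¹ • y) := clockMap_kidder hb s y
  -- the unsheared solution at the physical point
  have hPc : DifferentiableAt ℝ (fun w : ℝ × V3 => P₀ w.1 w.2) (clockMap a (s, y)) :=
    hcm ▸ differentiableAt_of_slab hP₀ hsT _
  have hΘc : DifferentiableAt ℝ (fun w : ℝ × V3 => Θ₀ w.1 w.2) (clockMap a (s, y)) :=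
    hcm ▸ differentiableAt_of_slab hΘ₀ hsT _
  have hUc : DifferentiableAt ℝ (fun w : ℝ × V3 => U₀ w.1 w.2) (clockMap a (s, y)) :=
    hcm ▸ differentiableAt_of_slab hU₀ hsT _
  have hE0 : EulerZAt (fun _ => 0) (fun _ => 0) (fun _ => 1) (fun w : ℝ × V3 => P₀ w.1 w.2)
      (fun w : ℝ × V3 => Θ₀ w.1 w.2) (fun w : ℝ × V3 => U₀ w.1 w.2) (clockMap a (s, y)) := by
    rw [hcm, eulerZAt_one_iff_athermalEulerAt (differentiableAt_of_slab hP₀ hsT _)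
      (differentiableAt_of_slab hΘ₀ hsT _) (differentiableAt_of_slab hU₀ hsT _)]
    exact hsol _ hsT _
  -- the dual system (verbatim the three residual identities of `stub_projectiveCovariance`, `a ≠ 0`)
  have hEd : EulerZAt (fun s => 0 * (a + s) / a) (fun s => 2 / (a + s)) (fun _ => 1)
      (dualDensity a fun w : ℝ × V3 => P₀ w.1 w.2) (dualTemperature a fun w : ℝ × V3 => Θ₀ w.1 w.2)
      (dualVelocity a fun w : ℝ × V3 => U₀ w.1 w.2) (s, y) := by
    unfold EulerZAt at hE0 ⊢
    exact ⟨(eq_zero_iff_of_eq_mul (dual_mass hm hPc hUc) (pow_ne_zero 5 hℓ)).mp hE0.1,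
      fun j => (eq_zero_iff_of_eq_mul (dual_momentum ha hm 0 (fun _ => 1) hPc hΘc hUc
        (differentiableAt_const _) j) (pow_ne_zero 6 hℓ)).mp (hE0.2.1 j),
      (eq_iff_of_sub_eq_mul_sub (dual_temperature ha hm 0 (fun _ => 1) (fun w : ℝ × V3 => P₀ w.1 w.2) hΘc hUc)
        (pow_ne_zero 4 hℓ)).mp
        hE0.2.2⟩
  -- differentiability of the dual fields at `(s, y)`
  have hDd : DifferentiableAt ℝ (dualDensity a fun w : ℝ × V3 => P₀ w.1 w.2) (s, y) :=
    ((hasFDerivAt_clockFactor_pow hm 3).mul (hasFDerivAt_comp_clockMap hm hPc)).differentiableAt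
  have hTd : DifferentiableAt ℝ (dualTemperature a fun w : ℝ × V3 => Θ₀ w.1 w.2) (s, y) :=
    ((hasFDerivAt_clockFactor_pow hm 2).mul (hasFDerivAt_comp_clockMap hm hΘc)).differentiableAt
  have hVd : DifferentiableAt ℝ (dualVelocity a fun w : ℝ × V3 => U₀ w.1 w.2) (s, y) :=
    differentiableAt_euclidean.mpr fun j => (hasFDerivAt_dualVelocity_apply hm hUc j).differentiableAt
  rw [dualDensity_kidder hb, dualTemperature_kidder hb, dualVelocity_kidder hb] at hEd
  rw [dualDensity_kidder hb] at hDd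
  rw [dualTemperature_kidder hb] at hTd
  rw [dualVelocity_kidder hb] at hVd
  exact (eulerZAt_one_iff_athermalEulerAt hDd hTd hVd _ _).mp hEd

include hsol in
/-- **Kidder transform, `b = 0`** (the identity). [folklore] -/
theorem athermalEulerAt_kidder_zero {s : ℝ} (hsT : s < T) (y : V3) :
    AthermalEulerAt (fun _ => 1) (kScalar 3 P₀ 0) (kScalar 2 Θ₀ 0) (kVel U₀ 0) s y := by
  have h1 : kScalar 3 P₀ 0 = P₀ := funext fun t => funext fun x => kScalar_zero 3 P₀ t x
  have h2 : kScalar 2 Θ₀ 0 = Θ₀ := funext fun t => funext fun x => kScalar_zero 2 Θ₀ t x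
  have h3 : kVel U₀ 0 = U₀ := funext fun t => funext fun x => kVel_zero U₀ t x
  rw [h1, h2, h3]
  exact hsol s hsT y

end Transform

end MemberCoreProof

open MemberCoreProof in
/-- **The Kidder image of an ideal solution is an ideal solution** (projective symmetry of the monatomic
ideal gas; D. Serre 1997, Prop. 2.1; R. E. Kidder 1974). If curried fields `(P₀, Θ₀, U₀)` are jointly `C¹`
on the open slab `{t < T} × ℝ³` and solve `AthermalEulerAt (fun _ => 1)` there, then for every knob value
`b` the fields `kScalar 3 P₀ b = λ³P₀(λt, λy)`, `kScalar 2 Θ₀ b = λ²Θ₀(λt, λy)`,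
`kVel U₀ b = λ(U₀(λt, λy) − b y)`, `λ = (1 − bt)⁻¹`, solve it at every `(t, y)` with `0 < 1 − bt` and
`λt < T` (for `b ≠ 0` via the residual identities `dual_mass/momentum/temperature` of the clock map with
`a = −1/b` and the bridge `eulerZAt_one_iff_athermalEulerAt`; `b = 0` is the identity). [folklore] -/
theorem memberCore_kidder_solves : ∀ (T b : ℝ) (P₀ Θ₀ : ℝ → V3 → ℝ) (U₀ : ℝ → V3 → V3),
    ContDiffOn ℝ 1 (fun w : ℝ × V3 => P₀ w.1 w.2) (Set.Iio T ×ˢ Set.univ) →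
    ContDiffOn ℝ 1 (fun w : ℝ × V3 => Θ₀ w.1 w.2) (Set.Iio T ×ˢ Set.univ) →
    ContDiffOn ℝ 1 (fun w : ℝ × V3 => U₀ w.1 w.2) (Set.Iio T ×ˢ Set.univ) →
    (∀ t, t < T → ∀ x : V3, AthermalEulerAt (fun _ => 1) P₀ Θ₀ U₀ t x) →
    ∀ (s : ℝ) (y : V3), 0 < 1 - b * s → (1 - b * s)⁻¹ * s < T →
      AthermalEulerAt (fun _ => 1) (kScalar 3 P₀ b) (kScalar 2 Θ₀ b) (kVel U₀ b) s y := by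
  intro T b P₀ Θ₀ U₀ hP₀ hΘ₀ hU₀ hsol s y hs hsT
  by_cases hb : b = 0
  · subst hb
    exact athermalEulerAt_kidder_zero hsol (by simpa using hsT) y
  · exact athermalEulerAt_kidder_of_ne hP₀ hΘ₀ hU₀ hsol hb hs hsT y

end Summit.AtomisticToContinuum.HydrodynamicLimit.Theorems.KidderKnobMelnikov

end
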